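import Literature.Probability.RandomPlanarGeometry.HexSAWSurfaceYcGrowth
import HarnessLib

/-!
# The strip thresholds are non-increasing: `y_{T+1} ≤ y_T`, with infimum `y* = 1 + √2` (BBdGDCG14, Corollary 8 — monotone half, weak form)

Topic `Literature/Probability/RandomPlanarGeometry` (continues the capstone `HexSAWSurfaceFugacity.lean` — `HV.stripYT T = y_T`,
the threshold below which the `y`-weighted critical bridge class `L ↦ B_{T,L}(x_c; y) = HV.stripGFy T L (IsBetaDart T) y` of the
Duminil-Copin–Smirnov strip `S_{T,L}` stays bounded, with `HV.yStar_le_stripYT : y* ≤ y_T` and `HV.tendsto_stripYT_yStar : y_{T+1} → y*`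
— and the one-row lift `HV.liftWalk`, `HV.shiftUp` of `HexSAWSurfaceYcGrowth.lean`).  Source: N. R. Beaton, M. Bousquet-Mélou,
J. de Gier, H. Duminil-Copin, A. J. Guttmann, *The critical fugacity for surface adsorption of self-avoiding walks on the honeycomb
lattice is `1 + √2`*, Comm. Math. Phys. 326 (2014) 727–754, arXiv:1109.0358v5, §3.2, Corollary 8 (p. 12): "There exists a unique
`y_T > 0` such that `ρ_T(y_T) = x_c := 1/μ`. The series (in `y`) `A_T(x_c, y)`, `B_T(x_c, y)` and `C_T(x_c, y)` have radius of
convergence `y_T`, and `y_T` decreases to the critical fugacity `y_c` as `T` goes to infinity."; proof (p. 13): "since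
`ρ_T(y_T) = x_c` and `ρ_{T+1}(y) < ρ_T(y)` (Proposition 7), we have `ρ_{T+1}(y_T) < x_c` and thus `y_{T+1} < y_T`. Hence the
sequence `(y_T)_{T ≥ 1}` decreases."

The capstone's docstring of `HV.stripYT` records "not formalised: `ρ_T(y_T) = x_c` and the monotonicity in `T`".  This file
proves the monotonicity in `T` in its weak form, by an elementary mechanism that does not pass through Proposition 7: the lift
`γ ↦ a · O · σ(γ)` (`σ` = translation by one hexagon row, `+2` levels) maps the bridges of `S_{T,L}` injectively to bridges of
`S_{T+1,L+1}` with two more vertices and the SAME number of top contacts, so `x_c² · B_{T,L}(x_c; y) ≤ B_{T+1,L+1}(x_c; y)` for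
every `y ≥ 0`; hence the boundedness set of `S_{T+1}` lies inside that of `S_T` and `y_{T+1} ≤ y_T`.  With the capstone's limit
the sequence `T ↦ y_{T+1}` is non-increasing with infimum `y*` (the weak reading of "`y_T` decreases to `y*`": antitone + limit;
the STRICT decrease is printed and is not proved here).

## Main statements (namespace `Literature.Probability.RandomPlanarGeometry.SAW.HV`, all proved, no hypotheses beyond `1 ≤ T`)

* `finalDart_liftWalk`, `isBetaDart_shiftUp`, `surfContacts_liftWalk` — the lift shifts the final half-edge, keeps the `β` class
  (`T ↦ T + 1`) and the number of top contacts;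
* `mul_stripGFy_beta_le_succ` — **`x_c² · B_{T,L}(x_c; y) ≤ B_{T+1,L+1}(x_c; y)`** for `T ≥ 1`, every `L` and every `y ≥ 0`;
* `sq_mul_stripB_le_succ`, `sq_mul_stripBlim_le_succ`, `stripBlim_succ_mem_Icc` — the case `y = 1`: `x_c² B_T(x_c) ≤ B_{T+1}(x_c) ≤ B_T(x_c)`
  (the upper end is the tree's `stripBlim_succ_le`);
* `stripBddSet_succ_subset` — `stripBddSet (T+1) ⊆ stripBddSet T`;
* **`stripYT_succ_le`** — `y_{T+1} ≤ y_T` (`T ≥ 1`); `antitone_stripYT_succ`; `stripYT_succ_le_stripYT_one` (`y_{T+1} ≤ y_1`);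
* **`iInf_stripYT_succ`** — `⨅_T y_{T+1} = y* = 1 + √2` (with `tendsto_stripYT_yStar`): non-increasing, infimum `y*`.

Status in print / scope (label of record, lit-1 g14, 2026-08-23: CONSOLIDATION BY A DIFFERENT PROOF of the monotone half of
Cor. 8 — the printed clause is STRICT and comes with the limit, v5 p. 12 with Thm 2 for the value, the lane's `≤` by the lift
injection is the weak form by a different, injective mechanism — plus one XS lane inequality `x_c² B_{T,L}(x_c;y) ≤ B_{T+1,L+1}(x_c;y)`
/ `x_c² B_T ≤ B_{T+1}`, not located in print, a convenience window rather than a headline): the printed statement is the STRICT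
decrease `y_{T+1} < y_T`, deduced from Proposition 7
(`μ_T(1,y) < μ_{T+1}(1,y)`) and the first part of Corollary 8 (the three series have the common radius `ρ_T(y)`); neither the
strict form nor the common-radius statement is formalised here (the strict growth-rate inequality for every `y > 0` is the
lane's «HEX-STRIP-STRICT-Y» in the brick-wall bottom-weight frame).  Label: consolidation of a printed clause, weak form, by a
different (injective, weight-preserving) argument — lane «pcv-sawmu», a-p2 g9, 2026-08-23.
-/

noncomputable section

open Finset Filter Topology

namespace Literature.Probability.RandomPlanarGeometry.SAW.HV

variable {V : Finset HV} {P : List HV}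

/-! ### The lift on final half-edges, classes and top contacts -/

/-- The lift of `w :: (l ++ [u])` in `cons`/`append` form. [cite: BeatonBousquetMelouDeGierDuminilCopinGuttmann2014, §3.1, Proposition 5 (arXiv v5 p. 9: "For 0 < y ≤ 1, μ(y) = μ(1) = μ" — the classical one-row translation argument of [W75]/[HTW82], which the paper invokes but does not display; `liftWalk` is the lane's rendering)] -/
theorem liftWalk_cons_append (l : List HV) (u : HV) :
    liftWalk (wOut :: (l ++ [u])) = wOut :: ((hvOrigin :: shiftUp wOut :: l.map shiftUp) ++ [shiftUp u]) := by
  simp [liftWalk]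

/-- **The lift translates the final half-edge**: `finalDart (liftWalk γ) = σ (finalDart γ)`.
[cite: BeatonBousquetMelouDeGierDuminilCopinGuttmann2014, §3.1, Proposition 5 (arXiv v5 p. 9; the classical one-row translation of [W75]/[HTW82], not displayed in print — `liftWalk` is the lane's rendering); DuminilCopinSmirnov2012, §3 (Fig. 3: the levels)] -/
theorem finalDart_liftWalk (h : IsMidWalk V P) :
    finalDart (liftWalk P) = (shiftUp (finalDart P).1, shiftUp (finalDart P).2) := by
  rcases h.trivial_or_exists with rfl | ⟨l, u, hl, rfl⟩
  · rfl
  · rw [liftWalk_cons_append, finalDart_cons_append (List.cons_ne_nil _ _), finalDart_cons_append hl]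
    simp only [Prod.mk.injEq, and_true]
    rw [List.getLast_cons (by simp), List.getLast_cons (by simp [hl]), List.getLast_map]

/-- **The lift keeps the `β` class**: a `β` half-edge of `S_T` (top level `2T − 1`, pointing up) is sent to a `β` half-edge of
`S_{T+1}` (top level `2T + 1`). [cite: DuminilCopinSmirnov2012, §3 (β: the top boundary mid-edges of S_{T,L})] -/
theorem isBetaDart_shiftUp {T : ℕ} {d : HV × HV} (h : IsBetaDart T d) :
    IsBetaDart (T + 1) (shiftUp d.1, shiftUp d.2) := by
  obtain ⟨⟨a, b, c⟩, v⟩ := d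
  obtain ⟨h1, h2, h3⟩ := h
  simp only at h1 h2 h3
  subst h3 h2
  refine ⟨?_, rfl, ?_⟩
  · simp only [shiftUp, h1]; push_cast; ring
  · simp only [shiftUp]

/-- **The lift keeps the number of top contacts** (`T ≥ 1`): the two new visited vertices `O`, `σ(w)` sit on levels `0`, `1`,
and `σ` moves level `2T − 1` to level `2T + 1`, the top level of `S_{T+1}`.
[cite: BeatonBousquetMelouDeGierDuminilCopinGuttmann2014, §2 (arXiv v5 p. 4: c(γ), the number of contacts with the surface) and §3.1 Proposition 5 (p. 9; the classical one-row translation, not displayed in print)] -/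
theorem surfContacts_liftWalk {T L : ℕ} (hT : 1 ≤ T) (h : IsMidWalk (stripV T L) P) :
    surfContacts (T + 1) (liftWalk P) = surfContacts T P := by
  rw [surfContacts, surfContacts, h.inner_liftWalk]
  have hO : ¬ (lev hvOrigin = 2 * ((T + 1 : ℕ) : ℤ) - 1) := by
    simp only [lev_hvOrigin]; push_cast; omega
  have hw : ¬ (lev (shiftUp wOut) = 2 * ((T + 1 : ℕ) : ℤ) - 1) := by
    rw [lev_shiftUp, lev_wOut]; push_cast; omega
  rw [List.filter_cons_of_neg (by simpa using hO), List.filter_cons_of_neg (by simpa using hw), List.filter_map,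
    List.length_map]
  congr 1
  refine List.filter_congr fun v _ => ?_
  simp only [Function.comp_apply, lev_shiftUp, decide_eq_decide]
  push_cast
  constructor <;> intro hv <;> linarith

/-! ### `x_c² · B_{T,L}(x_c; y) ≤ B_{T+1,L+1}(x_c; y)` and the monotonicity of the thresholds -/

/-- **`x_c² · B_{T,L}(x_c; y) ≤ B_{T+1,L+1}(x_c; y)`** for `T ≥ 1`, every `L` and every `y ≥ 0`: the lift is a weight-`x_c²`,
contact-preserving injection of the bridges of `S_{T,L}` into the bridges of `S_{T+1,L+1}`.
[cite: BeatonBousquetMelouDeGierDuminilCopinGuttmann2014, §2, eq. (10) and Fig. 5 (arXiv v5 p. 6: B_{T,L}(x; y)) and Corollary 8 (p. 12: "y_T decreases"); lane: injective proof of the weak monotonicity] -/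
theorem mul_stripGFy_beta_le_succ {T : ℕ} (hT : 1 ≤ T) (L : ℕ) {y : ℝ} (hy : 0 ≤ y) :
    hexCriticalFugacity ^ 2 * stripGFy T L (IsBetaDart T) y ≤ stripGFy (T + 1) (L + 1) (IsBetaDart (T + 1)) y := by
  classical
  have hx : 0 < hexCriticalFugacity := hexCriticalFugacity_pos_lt_one.1
  set F := (midWalks (stripV T L)).filter (fun P => IsBetaDart T (finalDart P)) with hF
  have himg : F.image liftWalk ⊆ (midWalks (stripV (T + 1) (L + 1))).filter (fun P => IsBetaDart (T + 1) (finalDart P)) := by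
    intro P' hP'
    obtain ⟨P, hP, rfl⟩ := mem_image.1 hP'
    rw [mem_filter, mem_midWalks_iff] at hP ⊢
    refine ⟨hP.1.liftWalk, ?_⟩
    rw [finalDart_liftWalk hP.1]
    exact isBetaDart_shiftUp hP.2
  calc hexCriticalFugacity ^ 2 * stripGFy T L (IsBetaDart T) y
      = ∑ P ∈ F, hexCriticalFugacity ^ (mwLen P + 2) * y ^ surfContacts T P := by
        rw [stripGFy, ← hF, mul_sum]
        refine sum_congr rfl fun P _ => ?_
        rw [pow_add]; ring
    _ = ∑ P' ∈ F.image liftWalk, hexCriticalFugacity ^ mwLen P' * y ^ surfContacts (T + 1) P' := by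
        rw [sum_image fun _ _ _ _ h => liftWalk_injective h]
        refine sum_congr rfl fun P hP => ?_
        have hP' := mem_midWalks_iff.1 (mem_filter.1 hP).1
        rw [mwLen_liftWalk hP'.two_le_length, surfContacts_liftWalk hT hP']
    _ ≤ stripGFy (T + 1) (L + 1) (IsBetaDart (T + 1)) y :=
        sum_le_sum_of_subset_of_nonneg himg fun _ _ _ => mul_nonneg (pow_nonneg hx.le _) (pow_nonneg hy _)

/-- **`x_c² · B_{T,L}(x_c) ≤ B_{T+1,L+1}(x_c)`** (`T ≥ 1`): the unweighted case `y = 1` of `mul_stripGFy_beta_le_succ`, an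
elementary LOWER companion to the tree's `B_{T+1}(x_c) ≤ B_T(x_c)` (`stripBlim_succ_le`, Krachun–Panagiotis Lemma 2.3).
[cite: DuminilCopinSmirnov2012, §3 (B_{T,L}^x; proof of Theorem 1: the strips S_T ⊂ S_{T+1}); lane: injective lower companion, not stated in print] -/
theorem sq_mul_stripB_le_succ {T : ℕ} (hT : 1 ≤ T) (L : ℕ) :
    hexCriticalFugacity ^ 2 * stripB T L hexCriticalFugacity ≤ stripB (T + 1) (L + 1) hexCriticalFugacity := by
  have h := mul_stripGFy_beta_le_succ hT L zero_le_one
  rwa [stripGFy_beta_one, stripGFy_beta_one] at h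

/-- **`x_c² · B_T(x_c) ≤ B_{T+1}(x_c)`** (`T ≥ 1`): with `stripBlim_succ_le`, the critical bridge masses of consecutive strips
compare within the factor `x_c² = 1/(2 + √2)`: `x_c² B_T ≤ B_{T+1} ≤ B_T`.
[cite: DuminilCopinSmirnov2012, §3 (B_T = lim_L B_{T,L}; proof of Theorem 1); lane: injective lower companion, not stated in print] -/
theorem sq_mul_stripBlim_le_succ {T : ℕ} (hT : 1 ≤ T) :
    hexCriticalFugacity ^ 2 * stripBlim T ≤ stripBlim (T + 1) := by
  have hx2 : 0 < hexCriticalFugacity ^ 2 := pow_pos hexCriticalFugacity_pos_lt_one.1 2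
  rw [mul_comm, ← le_div_iff₀ hx2]
  refine ciSup_le fun L => ?_
  rw [le_div_iff₀ hx2, mul_comm]
  exact (sq_mul_stripB_le_succ hT L).trans (stripB_le_lim DuminilCopinSmirnov2012_lemma2_holds (by omega) (L + 1))

/-- `B_{T+1}(x_c) ∈ [x_c² B_T(x_c), B_T(x_c)]` (`T ≥ 1`). [cite: DuminilCopinSmirnov2012, §3 (B_T); KrachunPanagiotis2026, Lemma 2.3 (B_{T+1} ≤ B_T); lane: the lower end] -/
theorem stripBlim_succ_mem_Icc {T : ℕ} (hT : 1 ≤ T) :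
    stripBlim (T + 1) ∈ Set.Icc (hexCriticalFugacity ^ 2 * stripBlim T) (stripBlim T) :=
  ⟨sq_mul_stripBlim_le_succ hT, stripBlim_succ_le hT⟩

/-- **The boundedness sets are nested**: `stripBddSet (T+1) ⊆ stripBddSet T` (`T ≥ 1`) — if `L ↦ B_{T+1,L}(x_c; y)` is bounded,
so is `L ↦ B_{T,L}(x_c; y) ≤ x_c⁻² B_{T+1,L+1}(x_c; y)`.
[cite: BeatonBousquetMelouDeGierDuminilCopinGuttmann2014, Corollary 8 (arXiv v5 p. 12: "y_T decreases to the critical fugacity y_c"); lane: weak form by the lift] -/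
theorem stripBddSet_succ_subset {T : ℕ} (hT : 1 ≤ T) : stripBddSet (T + 1) ⊆ stripBddSet T := by
  have hx : 0 < hexCriticalFugacity := hexCriticalFugacity_pos_lt_one.1
  rintro y ⟨hy, ⟨K, hK⟩⟩
  refine ⟨hy, ⟨K / hexCriticalFugacity ^ 2, ?_⟩⟩
  rintro _ ⟨L, rfl⟩
  have h1 := mul_stripGFy_beta_le_succ hT L hy
  have h2 : stripGFy (T + 1) (L + 1) (IsBetaDart (T + 1)) y ≤ K := hK ⟨L + 1, rfl⟩
  rw [le_div_iff₀ (pow_pos hx 2), mul_comm]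
  exact h1.trans h2

/-- The boundedness set of `S_{T+1}` is nonempty (it contains `(0, y*)`). [cite: BeatonBousquetMelouDeGierDuminilCopinGuttmann2014, §4.2, eq. (17) (arXiv v5 p. 14: boundedness below y*)] -/
theorem stripBddSet_succ_nonempty (T : ℕ) : (stripBddSet (T + 1)).Nonempty :=
  ⟨yStar / 2, mem_stripBddSet_of_lt (by omega) (half_pos yStar_pos) (half_lt_self yStar_pos)⟩

/-- **`y_{T+1} ≤ y_T`** (`T ≥ 1`): the strip thresholds are non-increasing (weak form of Corollary 8's printed strict "y_{T+1} < y_T").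
[cite: BeatonBousquetMelouDeGierDuminilCopinGuttmann2014, Corollary 8 (arXiv v5 p. 12; proof p. 13: "y_{T+1} < y_T. Hence the sequence (y_T)_{T ≥ 1} decreases."); lane: weak form, by the lift injection instead of Proposition 7] -/
theorem stripYT_succ_le {T : ℕ} (hT : 1 ≤ T) : stripYT (T + 1) ≤ stripYT T :=
  csSup_le_csSup (stripBddSet_bddAbove hT) (stripBddSet_succ_nonempty T) (stripBddSet_succ_subset hT)

/-- `T ↦ y_{T+1}` is antitone. [cite: BeatonBousquetMelouDeGierDuminilCopinGuttmann2014, Corollary 8 (arXiv v5 p. 12; proof p. 13: "the sequence (y_T)_{T ≥ 1} decreases")] -/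
theorem antitone_stripYT_succ : Antitone fun T : ℕ => stripYT (T + 1) :=
  antitone_nat_of_succ_le fun T => stripYT_succ_le (by omega)

/-- `y_{T+1} ≤ y_1` for every `T`. [cite: BeatonBousquetMelouDeGierDuminilCopinGuttmann2014, Corollary 8 (arXiv v5 p. 12; proof p. 13: "the sequence (y_T)_{T ≥ 1} decreases")] -/
theorem stripYT_succ_le_stripYT_one (T : ℕ) : stripYT (T + 1) ≤ stripYT 1 :=
  antitone_stripYT_succ (Nat.zero_le T)

/-- `y* ≤ y_{T+1} ≤ y_1` for every `T`. [cite: BeatonBousquetMelouDeGierDuminilCopinGuttmann2014, Corollary 8 (arXiv v5 p. 12) with §4.2 eq. (17) (p. 14: y* ≤ y_T)] -/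
theorem stripYT_succ_mem_Icc (T : ℕ) : stripYT (T + 1) ∈ Set.Icc yStar (stripYT 1) :=
  ⟨yStar_le_stripYT (by omega), stripYT_succ_le_stripYT_one T⟩

/-- **`⨅_T y_{T+1} = y* = 1 + √2`**: the thresholds are non-increasing with infimum `y*` (antitone, bounded below by `y*`, with limit `y*` —
the capstone's `tendsto_stripYT_yStar`).
[cite: BeatonBousquetMelouDeGierDuminilCopinGuttmann2014, Corollary 8 (arXiv v5 p. 12: "y_T decreases to the critical fugacity y_c as T goes to infinity") and Theorem 2 (p. 3: y_c = 1 + √2 = y*; Theorem 10, p. 14, is its key input)] -/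
theorem iInf_stripYT_succ : (⨅ T : ℕ, stripYT (T + 1)) = yStar := by
  have hbdd : BddBelow (Set.range fun T : ℕ => stripYT (T + 1)) :=
    ⟨yStar, by rintro _ ⟨T, rfl⟩; exact yStar_le_stripYT (by omega)⟩
  exact tendsto_nhds_unique (tendsto_atTop_ciInf antitone_stripYT_succ hbdd) tendsto_stripYT_yStar

/-- `y* ≤ y_{T+1}` as an infimum bound: every threshold dominates the limit. [cite: BeatonBousquetMelouDeGierDuminilCopinGuttmann2014, Corollary 8 (arXiv v5 p. 12; proof p. 13: "y_T > y_c for all T. Hence ȳ ≥ y_c")] -/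
theorem iInf_stripYT_succ_le (T : ℕ) : (⨅ T : ℕ, stripYT (T + 1)) ≤ stripYT (T + 1) := by
  rw [iInf_stripYT_succ]
  exact yStar_le_stripYT (by omega)

end Literature.Probability.RandomPlanarGeometry.SAW.HV
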